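import Literature.NumberTheory.EllipticCurves.KellerYin2024.PotentiallyGoodOrdinaryAnalyticThree
import Summits.BirchSwinnertonDyer.BirchSwinnertonDyer.Theorems.SchneiderFreeAdditiveX3KYNonAnomalousTwistOfPrint
import Summits.BirchSwinnertonDyer.BirchSwinnertonDyer.Theorems.SchneiderFreeAdditiveX3KYBranchHalvesLambdaLe
import Summits.BirchSwinnertonDyer.BirchSwinnertonDyer.Theorems.SchneiderFreeAdditiveX3GordTwoBranchIMCDivOfKYBranch
import HarnessLib

/-!
# Route `SchneiderFreeAdditiveX3` (K1 door): Keller–Yin Thm. 3.5.1 IN BRANCH CURRENCY AT `p = 3` FOR A NON-ANOMALOUS TWIST, at every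
# signed Castella–Hsieh frame — `μ(𝓛_ε) = 0`, `λ(𝓛_ε) ≤ λ(𝔛)` (hence `= λ(𝔛)`) and `Ch_Λ(𝔛)·R₀⟦T⟧ = (𝓛_ε)` — FROM the Kolyvagin
# divisibility [DIV.dvd] (preprint) and the two analytic inputs typed at `p = 3` ([AN3] PUB-composed, [BR3] PUB) plus published facts

Cell `bsd-schneider-ideate`, seat `bsd-schneider-door-c5` (prover, generation 26; assembly layer; `--supports` 19177).
PARTITION: board row B6 ∩ X3 ∩ sst-twist, `r = 1`, (G-ord, `e = 2`) half at `p = 3` (2 411 pairs; the 686 NON-ANOMALOUS ones, kit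
j319291) of `Rank1Residual.partition` — types-the-object-of nothing new; DERIVES Keller–Yin's Thm. 3.5.1 sentence (branch currency) for
the door datum at `p = 3` from ONE preprint clause ([DIV.dvd]) and typed/published inputs; closes none of B6's cells (BSD NOT advanced).
bears_on: K1-door (19177 r3 `GordTwoBranchIMC`).

WHY.  After generations 22–25 the door's (G-ord) lower half at `p ≥ 5` / `p = 3 ∧ NAT` rested on PUB ∪ {[DIV.dvd], KYμ, [AN-λ≤], [BR]}, the
last three being Keller–Yin §3.5's ANALYTIC paragraph (preprint, and at `p ≥ 5` outside printed Eisenstein-congruence theory: two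
`p`-ramified characters) and Rubin's theorem in a currency not typed for the door.  Generation 26's observation (memo FINDING-door-c5-g26 §2,
kernel arithmetic `…TwistThreeEisensteinSwap`): AT `p = 3` the twist character `χ_{−3}` IS `ω ≡ id (mod 3)`, so the `χ_ε`-branch of the
BDP measure of `f̃` is the measure of `θf̃`, and `E_2^{(ψ₁,ψ₂,N₊,N₋,N₀)} ⊗ ω ≡ E_2^{(ψ₂,ψ₁,N₋,N₊,N₀)} (mod 3)`: the analytic paragraph becomes
Castella–Grossi–Lee–Skinner 2022 Thms. 2.2.1/2.2.2 VERBATIM for the pair `(φ′, ψ′) = (φ_V⁻¹, ωφ_V) = W[3]^{ss}` with `φ′` UNRAMIFIED at `3`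
— typed as `KellerYin2024.thm351_anacong_branch_three` [AN3] (PUB-composed, audit pending) — and Rubin's inputs are CGLS Thm. 1.2.2 +
(2.16) for that pair — typed as `KellerYin2024.thm122_charLambda_pair_three` [BR3] (PUBLISHED).  This file closes the chain in the kernel:

* §1 **`exists_firstUnitCoeffAt_le_lambdaInvariant_three`** — [INV.λ≤] ∧ KYμ at `p = 3`: for Keller–Yin's datum `PotOrdSetting ι' W K v v̄ κ N`
  with `W` in the (G-ord) cell (`ClassX3 ∧ SubGordTwo`) and the non-anomalous-twist clause NAT, the partner `f′`, a residual pair of `W_K[3]`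
  with a `3`-UNRAMIFIED member carrying a Hecke character and a Katz frame, and every SIGNED Castella–Hsieh branch frame `L` of `(f′, χ_ε)`:
  `∃ n, FirstUnitCoeffAt L n ∧ n ≤ λ(X_ac^∅(W_K))` — from [AN3] (`n + Σ λ𝒫_w(W_K) = 2nφ + ΣΣ`), [BR3] (`λ(𝔛_θ) = nφ` for both characters,
  at the strict duals that exist: `nonempty_grDualData_char`) and generation 25's PUBLISHED-fact door inequality
  `λ(𝔛_{θsub}) + λ(𝔛_{θquot}) + ΣΣ ≤ λ(𝔛) + Σ λ𝒫_w(W_K)` (`KYNonAnomalousTwist.add_add_sum_le_…_of_subGordTwo_of_forall_twist_of_facts`,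
  ten published facts); `omega`.
* §2 **`xac_charIdeal_map_eq_span_three_of_dvd`** — Keller–Yin Thm. 3.5.1's CONCLUSION in branch currency at that frame, along any structure
  map `j : ℤ_3 → R₀`: `Ch_Λ(X_ac^∅(W_K))·R₀⟦T⟧ = (L)` AND `n = λ(𝔛)` — from §1, [DIV.dvd] `thm336_dvd_branch_OPEN` (`p^k·L ∈ Ch_Λ(𝔛)·R₀⟦T⟧`,
  PREPRINT: the Kolyvagin half, Thm. 3.3.6 ∘ Prop. 3.4.4), `𝔛` torsion with `μ = 0` from CGLS Prop. 14 (generation 25's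
  `isTorsion_muInvariant_eq_zero_empty_of_prop14_of_subGordTwo_of_forall_twist`, PUBLISHED), and generation 24's hinge
  `KYBranchHalves.charIdeal_map_eq_span_of_C_pow_mul_mem_of_firstUnitCoeff_le`.
* §3 corollaries: `not_C_dvd_three_of_anacong` (Keller–Yin's "`μ(𝓛_ε) = 0`" clause shape `¬ C 3 ∣ L`), `xac_charIdeal_map_le_span_three_of_dvd`
  (the door direction H3 at the frame, `≤`, the input of generation 21's isogeny descent).

INPUT LEDGER after this file, (G-ord, `e = 2`) cell at `p = 3` ∧ NAT (686 census pairs), Keller–Yin Thm. 3.5.1 at the Keller–Yin datum: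
{[DIV.dvd] (PREPRINT — and at `p = 3` OUTSIDE the preprint's printed range `p > 3` for its Kolyvagin-system inputs, door-c3 g5 audit),
[AN3] (PUB-COMPOSED, audit pending), [BR3] (PUB)} ∪ eleven PUBLISHED named facts (CGLS22 Props. 1.2.5, 14, Cor. 1.2.6 ×2; Greenberg 2016
4.1.1, 2.6.3; Greenberg 2006 4.1, 4.2, §5A, 3.2).  The auxiliary data (a residual pair with a `3`-unramified member, its Hecke character, its
Katz frame) are existence statements of the tree / CGLS Thm. 2.1.2, displayed as binders here (memo §4 lists them).

HONEST FRAMING: compositions of tree theorems, CONDITIONAL on the displayed hypotheses ([DIV.dvd] and [AN3] carry Keller–Yin claim tags —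
unrefereed preprint; [AN3]'s `p = 3` composition is this seat's, audit pending; [BR3] and the eleven facts are published theorems typed
as Props, not proved in the tree); no definition, no named fact introduced here, no `sorry`; the crux stays OPEN; BSD proved for no curve;
«closes rung: none».  References: Keller–Yin arXiv:2410.23241 Thm. 3.3.6, Prop. 3.4.4, §3.5, Thm. 3.5.1 [KellerYin2024b]; CGLS 2022 Thms. 1.2.2,
2.2.1, 2.2.2, 2.2.4, Props. 1.2.5, 14 [CastellaGrossiLeeSkinner2022]; Kriz 2016 [Kriz2016]; Castella–Hsieh 2018 Def. 3.7/Prop. 3.8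
[CastellaHsieh2018]; Washington §7.1/§13.2 [Washington1997]; this seat p670905 (gen 24), p675460 (gen 25), p679286, p680016 (gen 26).
-/

set_option autoImplicit false
set_option linter.dupNamespace false -- the summit namespace `…BirchSwinnertonDyer.BirchSwinnertonDyer.Theorems` (Sub = Summit, D-0017) trips it

noncomputable section

open scoped Classical Pointwise NumberField

open WeierstrassCurve NumberField IsDedekindDomain Field PowerSeries
  Literature.NumberTheory.EllipticCurves Literature.NumberTheory.EllipticCurves.IwasawaAlgebra
  Literature.NumberTheory.EllipticCurves.GreenbergSelmer
  Literature.NumberTheory.EllipticCurves.GreenbergVatsal2000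
  Literature.NumberTheory.GaloisRepresentations IsDedekindDomain.HeightOneSpectrum
  Literature.NumberTheory.EllipticCurves.ModularForms
  Literature.NumberTheory.EllipticCurves.Rank1Residual Literature.NumberTheory.EllipticCurves.KellerYin2024
  Literature.NumberTheory.EllipticCurves.IwasawaDual Literature.NumberTheory.EllipticCurves.Castella2018.AcSelmer
  Literature.NumberTheory.IwasawaTheory Literature.NumberTheory.IwasawaTheory.Greenberg2016
  Literature.NumberTheory.IwasawaTheory.Greenberg2006
  Summit.BirchSwinnertonDyer.Rank1Residual Summit.BirchSwinnertonDyer.Rank1Residual.Additive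
  Summit.BirchSwinnertonDyer.BirchSwinnertonDyer.Theorems
  Summit.BirchSwinnertonDyer.BirchSwinnertonDyer.Theorems.SchneiderFree
  Summit.BirchSwinnertonDyer.BirchSwinnertonDyer.Theorems.SchneiderFreeAdditiveX3
  Summit.BirchSwinnertonDyer.BirchSwinnertonDyer.Theorems.SchneiderFreeAdditiveX3.KYNonAnomalousTwist
  Summit.BirchSwinnertonDyer.BirchSwinnertonDyer.Theorems.SchneiderFreeAdditiveX3.KYBranchHalves
open Literature.NumberTheory.EllipticCurves.CastellaGrossiLeeSkinner2022
  (cor126_residualCharacter_globalLift cor126_residualCharacter_localSurjective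
    prop125_characterGrSelmerDual_torsion_muZero_dim prop14_residualCharacterSelmer_finite IsKatzLFunction)

namespace Summit.BirchSwinnertonDyer.BirchSwinnertonDyer.Theorems.SchneiderFreeAdditiveX3.KYBranchThree

/-! ### §0 CGLS's set `S` as a Finset: the primes of `K` over `N` and not over `3` -/

/-- The primes of `K` dividing `N ≠ 0` and not `3` form a Finset with the membership predicate the typed facts use. [folklore] -/
theorem exists_finset_primes_over_not_three {K : Type} [Field K] [NumberField K] (N : ℕ) [NeZero N] :
    ∃ Sf : Finset (HeightOneSpectrum (𝓞 K)), ∀ w : HeightOneSpectrum (𝓞 K), w ∈ Sf ↔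
      (((N : ℤ) : 𝓞 K) ∈ w.asIdeal ∧ ((3 : ℕ) : 𝓞 K) ∉ w.asIdeal) := by
  have hI : Ideal.span {((N : ℤ) : 𝓞 K)} ≠ ⊥ := by
    rw [Ne, Ideal.span_singleton_eq_bot]; exact_mod_cast (NeZero.ne N)
  refine ⟨((Ideal.finite_factors hI).toFinset).filter (fun w ↦ ((3 : ℕ) : 𝓞 K) ∉ w.asIdeal), fun w ↦ ?_⟩
  rw [Finset.mem_filter, Set.Finite.mem_toFinset, Set.mem_setOf_eq, Ideal.dvd_span_singleton]

/-! ### §1 [INV.λ≤] and KYμ at `p = 3` for a non-anomalous twist, from [AN3], [BR3] and the published-fact door inequality -/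

section Three

/-- **[INV.λ≤] ∧ KYμ at `p = 3`, non-anomalous twist, at a SIGNED Castella–Hsieh frame.**  Data: Keller–Yin's standing datum
`PotOrdSetting ι' W K v v̄ κ N` at `p = 3` with `W` in the (G-ord, `e = 2`) cell and the non-anomalous-twist clause; `3 ∈ v`; the partner `f′`
with the twist relation; a residual pair `(θsub, θquot)` of `W_K[3]`; a member `θ₀` of the pair whose Hecke character `θ₀K` is UNRAMIFIED above
`3` with a Katz frame `Lφ` (CGLS Thm. 2.1.2); a signed branch frame `L` of `(f′, χ_ε)` (`e = ±1`, `Ω_p ∈ R₀ˣ`).  Conclusion: `L` has a first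
unit coefficient at some `n ≤ λ(X_ac^∅(W_K))` — "`μ(𝓛_ε) = 0` and `λ(𝓛_ε) ≤ λ(𝔛)`".  From [AN3] `n + Σ λ𝒫_w(W_K) = 2nφ + ΣΣ`, [BR3]
`λ(𝔛_{θsub}) = λ(𝔛_{θquot}) = nφ` (strict duals exist: `nonempty_grDualData_char`), and the door inequality of generation 25 (PUB facts)
`λ(𝔛_{θsub}) + λ(𝔛_{θquot}) + ΣΣ ≤ λ(𝔛) + Σ λ𝒫_w(W_K)`.  CONDITIONAL on the displayed named statements; nothing asserted about any curve.
[claim: KellerYin2024PotOrd, status: under-review]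
[cite: KellerYin2024b, §3.5 and Thm. 3.5.1 (arXiv:2410.23241 p. 20) (the λ-comparison, preprint; hypotheses)]
[cite: CastellaGrossiLeeSkinner2022, Thms. 1.2.2, 2.2.2, 2.2.4 and Props. 1.2.5, 14 (arXiv:2008.02571v2)] -/
theorem exists_firstUnitCoeffAt_le_lambdaInvariant_three
    (hAN : thm351_anacong_branch_three) (hBR : thm122_charLambda_pair_three)
    (hprop125 : prop125_characterGrSelmerDual_torsion_muZero_dim) (hfact : prop14_residualCharacterSelmer_finite)
    (hlift : cor126_residualCharacter_globalLift) (hlocal : cor126_residualCharacter_localSurjective)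
    (h411 : prop411_selmer_isAlmostDivisible) (h263 : prop263_sur_of_crk) (h41 : prop41_globalEulerPoincareCorank)
    (h42 : prop42_localEulerPoincareCorank) (h5A : sec5A_localH2_subsingleton_of_LOC1)
    (h32 : prop32_cohomology_isCofinitelyGenerated)
    (ι' : PadicAlgCl 3 ≃+* ℂ) (W : WeierstrassCurve ℚ) [W.IsElliptic] [W.IsGloballyMinimal]
    (K : Type) [Field K] [NumberField K] [IsGalois ℚ K]
    (v vbar : HeightOneSpectrum (𝓞 K)) (κ : ZpExtension K 3) (γ : absoluteGaloisGroup K)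
    [hγ : Fact (κ.IsTopGenerator γ)] {N : ℕ} [NeZero N] {f : CuspForm (CongruenceSubgroup.Gamma0 N) 2}
    (hf : IsNewformOf W f) (hS : PotOrdSetting ι' W K v vbar κ N)
    (hX : ClassX3 W 3) (hSG : SubGordTwo W 3)
    (hna : ∀ (V : WeierstrassCurve ℚ) [V.IsElliptic] [V.IsGloballyMinimal] (C : VariableChange ℚ),
      GoodOrd V 3 → C • V.quadraticTwist ((-1 : ℚ) ^ (3 / 2) * (3 : ℕ)) = W → ¬ (3 : ℤ) ∣ V.frobeniusTrace 3 - 1)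
    (hv3 : ((3 : ℕ) : 𝓞 K) ∈ v.asIdeal)
    {N' : ℕ} [NeZero N'] {f' : CuspForm (CongruenceSubgroup.Gamma0 N') 2} (hf' : IsNewform0 f') (hN' : ¬ 3 ∣ N')
    (htw : ∃ S : Finset ℕ, ∀ ℓ : ℕ, ℓ.Prime → ℓ ∉ S →
      cuspCoeff f ℓ = ((legendreSym 3 ℓ : ℤ) : ℂ) * cuspCoeff f' ℓ)
    {θsub θquot : FramedGaloisRep K (padicCoeffIntegers (∅ : Set (PadicAlgCl 3))) 1}
    (hpair : IsResidualPairOver (W.baseChange K) 3 θsub θquot)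
    {θ₀ : FramedGaloisRep K (padicCoeffIntegers (∅ : Set (PadicAlgCl 3))) 1} (hθ₀ : θ₀ = θsub ∨ θ₀ = θquot)
    {θ₀K : HeckeCharacter K} (hθ₀K : IsHeckeCharOf ι' θ₀ θ₀K) (hv0 : θ₀K.IsUnramifiedAt v) (hvbar0 : θ₀K.IsUnramifiedAt vbar)
    {Cbar : Finset (HeightOneSpectrum (𝓞 K))} (hCbar : ∀ u ∈ Cbar, ¬ θ₀K.IsUnramifiedAt u)
    {ΩK' : ℂ} {Ωp' : (unrIntegers 3)ˣ} {Lφ : UnrSeries 3} (hΩK' : ΩK' ≠ 0)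
    (hLφ : IsKatzLFunction ι' v vbar Cbar κ γ θ₀K ΩK' ((Ωp' : unrIntegers 3) : ℂ_[3]) Lφ)
    {e : ℂ} {ΩK : ℂ} {Ωp : (unrIntegers 3)ˣ} {L : UnrSeries 3} (he : e = 1 ∨ e = -1) (hΩK : ΩK ≠ 0)
    (hL : IsBranchBDPLFunction ι' v κ γ f' (KellerYin2024.genusHeckeCharacter K 3) e ΩK ((Ωp : unrIntegers 3) : ℂ_[3]) L) :
    ∃ n : ℕ, FirstUnitCoeffAt L n ∧
      n ≤ lambdaInvariant 3 (XAc (W.baseChange K) 3 κ vbar (∅ : Set (HeightOneSpectrum (𝓞 K))) γ) := by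
  -- CGLS's `S`, keyed to `N` and to `N_W = N`
  obtain ⟨Sf, hSf⟩ := exists_finset_primes_over_not_three (K := K) N
  have hSf' : ∀ w : HeightOneSpectrum (𝓞 K), w ∈ Sf ↔
      (((W.conductorNorm ℤ : ℤ) : 𝓞 K) ∈ w.asIdeal ∧ ((3 : ℕ) : 𝓞 K) ∉ w.asIdeal) := by
    rw [hS.level]; exact hSf
  -- [AN3] and [BR3]
  obtain ⟨n, nφ, hLn, hLφn, hcount⟩ := hAN ι' W K v vbar κ γ hf hS hna hf' hN' htw θsub θquot hpair Sf hSf θ₀ hθ₀ θ₀K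
    hθ₀K hv0 hvbar0 Cbar hCbar ΩK' Ωp' Lφ hΩK' hLφ e ΩK Ωp L he hΩK hL
  obtain ⟨nφ', hLφn', hchar⟩ := hBR ι' W K v vbar κ γ hf hS hna θsub θquot hpair θ₀ hθ₀ θ₀K hθ₀K hv0 hvbar0 Cbar hCbar
    ΩK' Ωp' Lφ hΩK' hLφ
  obtain rfl : nφ = nφ' := hLφn.unique hLφn'
  -- strict duals of the two character modules, and their `λ`
  obtain ⟨Dsub⟩ := nonempty_grDualData_char (∅ : Set (PadicAlgCl 3)) (θ := θsub) (κ := κ) (vbar := vbar)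
    (S₀ := (∅ : Set (HeightOneSpectrum (𝓞 K)))) hγ.out
  obtain ⟨Dquot⟩ := nonempty_grDualData_char (∅ : Set (PadicAlgCl 3)) (θ := θquot) (κ := κ) (vbar := vbar)
    (S₀ := (∅ : Set (HeightOneSpectrum (𝓞 K)))) hγ.out
  have hsub : lambdaInvariant 3 Dsub.X = nφ := hchar θsub (Or.inl rfl) Dsub
  have hquot : lambdaInvariant 3 Dquot.X = nφ := hchar θquot (Or.inr rfl) Dquot
  -- the published-fact door inequality (generation 25)
  have hineq := add_add_sum_le_lambdaInvariant_xAc_empty_add_sum_curveLocalLambda_of_subGordTwo_of_forall_twist_of_facts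
    hprop125 hfact hlift hlocal h411 h263 h41 h42 h5A h32 W K vbar κ γ Sf (by norm_num) hX hSG hna hS.imagQuad
    (by rw [hS.level]; exact hS.heegner) hS.split hv3 hS.mem_vbar hS.vbar_ne hS.anticyclotomic hSf' θsub θquot hpair Dsub Dquot
  rw [hsub, hquot] at hineq
  refine ⟨n, hLn, ?_⟩
  omega

/-- **Keller–Yin's "`μ(𝓛_ε) = 0`" clause at `p = 3`** (the conclusion shape of `thm351_mu_zero_branch_OPEN`: `¬ C 3 ∣ L` at the signed frame),
under the data of `exists_firstUnitCoeffAt_le_lambdaInvariant_three`. [claim: KellerYin2024PotOrd, status: under-review]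
[cite: KellerYin2024b, Thm. 3.5.1, the clause μ(𝓛_ε) = 0 (arXiv:2410.23241 p. 20)] [cite: Washington1997, §7.1 Prop. 7.2] -/
theorem not_C_dvd_three_of_anacong
    (hAN : thm351_anacong_branch_three) (hBR : thm122_charLambda_pair_three)
    (hprop125 : prop125_characterGrSelmerDual_torsion_muZero_dim) (hfact : prop14_residualCharacterSelmer_finite)
    (hlift : cor126_residualCharacter_globalLift) (hlocal : cor126_residualCharacter_localSurjective)
    (h411 : prop411_selmer_isAlmostDivisible) (h263 : prop263_sur_of_crk) (h41 : prop41_globalEulerPoincareCorank)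
    (h42 : prop42_localEulerPoincareCorank) (h5A : sec5A_localH2_subsingleton_of_LOC1)
    (h32 : prop32_cohomology_isCofinitelyGenerated)
    (ι' : PadicAlgCl 3 ≃+* ℂ) (W : WeierstrassCurve ℚ) [W.IsElliptic] [W.IsGloballyMinimal]
    (K : Type) [Field K] [NumberField K] [IsGalois ℚ K]
    (v vbar : HeightOneSpectrum (𝓞 K)) (κ : ZpExtension K 3) (γ : absoluteGaloisGroup K)
    [hγ : Fact (κ.IsTopGenerator γ)] {N : ℕ} [NeZero N] {f : CuspForm (CongruenceSubgroup.Gamma0 N) 2}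
    (hf : IsNewformOf W f) (hS : PotOrdSetting ι' W K v vbar κ N)
    (hX : ClassX3 W 3) (hSG : SubGordTwo W 3)
    (hna : ∀ (V : WeierstrassCurve ℚ) [V.IsElliptic] [V.IsGloballyMinimal] (C : VariableChange ℚ),
      GoodOrd V 3 → C • V.quadraticTwist ((-1 : ℚ) ^ (3 / 2) * (3 : ℕ)) = W → ¬ (3 : ℤ) ∣ V.frobeniusTrace 3 - 1)
    (hv3 : ((3 : ℕ) : 𝓞 K) ∈ v.asIdeal)
    {N' : ℕ} [NeZero N'] {f' : CuspForm (CongruenceSubgroup.Gamma0 N') 2} (hf' : IsNewform0 f') (hN' : ¬ 3 ∣ N')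
    (htw : ∃ S : Finset ℕ, ∀ ℓ : ℕ, ℓ.Prime → ℓ ∉ S →
      cuspCoeff f ℓ = ((legendreSym 3 ℓ : ℤ) : ℂ) * cuspCoeff f' ℓ)
    {θsub θquot : FramedGaloisRep K (padicCoeffIntegers (∅ : Set (PadicAlgCl 3))) 1}
    (hpair : IsResidualPairOver (W.baseChange K) 3 θsub θquot)
    {θ₀ : FramedGaloisRep K (padicCoeffIntegers (∅ : Set (PadicAlgCl 3))) 1} (hθ₀ : θ₀ = θsub ∨ θ₀ = θquot)
    {θ₀K : HeckeCharacter K} (hθ₀K : IsHeckeCharOf ι' θ₀ θ₀K) (hv0 : θ₀K.IsUnramifiedAt v) (hvbar0 : θ₀K.IsUnramifiedAt vbar)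
    {Cbar : Finset (HeightOneSpectrum (𝓞 K))} (hCbar : ∀ u ∈ Cbar, ¬ θ₀K.IsUnramifiedAt u)
    {ΩK' : ℂ} {Ωp' : (unrIntegers 3)ˣ} {Lφ : UnrSeries 3} (hΩK' : ΩK' ≠ 0)
    (hLφ : IsKatzLFunction ι' v vbar Cbar κ γ θ₀K ΩK' ((Ωp' : unrIntegers 3) : ℂ_[3]) Lφ)
    {e : ℂ} {ΩK : ℂ} {Ωp : (unrIntegers 3)ˣ} {L : UnrSeries 3} (he : e = 1 ∨ e = -1) (hΩK : ΩK ≠ 0)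
    (hL : IsBranchBDPLFunction ι' v κ γ f' (KellerYin2024.genusHeckeCharacter K 3) e ΩK ((Ωp : unrIntegers 3) : ℂ_[3]) L) :
    ¬ C ((3 : ℕ) : unrIntegers 3) ∣ L := by
  obtain ⟨n, hLn, -⟩ := exists_firstUnitCoeffAt_le_lambdaInvariant_three hAN hBR hprop125 hfact hlift hlocal h411 h263 h41 h42
    h5A h32 ι' W K v vbar κ γ hf hS hX hSG hna hv3 hf' hN' htw hpair hθ₀ hθ₀K hv0 hvbar0 hCbar hΩK' hLφ he hΩK hL
  exact not_C_dvd_of_firstUnitCoeffAt hLn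

/-! ### §2 Keller–Yin Thm. 3.5.1 in branch currency at `p = 3` (non-anomalous twist) from [DIV.dvd] + [AN3] + [BR3] + published facts -/

/-- **Keller–Yin Thm. 3.5.1 (branch currency) at `p = 3` for a non-anomalous twist, at a signed frame, along any structure map `j`:**
`Ch_Λ(X_ac^∅(W_K))·R₀⟦T⟧ = (L)` and the first unit coefficient of `L` sits EXACTLY at `λ(𝔛)` ("`μ(𝔛) = μ(𝓛_ε) = 0`, `λ(𝔛) = λ(𝓛_ε)`,
consequently `Char_Λ(𝔛)Λ^ur = (𝓛_ε)`").  Inputs BY NAME: [DIV.dvd] `thm336_dvd_branch_OPEN` (the Kolyvagin half, Thm. 3.3.6 ∘ Prop. 3.4.4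
— PREPRINT), [AN3] `thm351_anacong_branch_three` (PUB-composed at `p = 3`, audit pending), [BR3] `thm122_charLambda_pair_three` (PUBLISHED)
and eleven published facts; `𝔛` torsion with `μ = 0` from CGLS Prop. 14 (generation 25), §1, and generation 24's hinge
`charIdeal_map_eq_span_of_C_pow_mul_mem_of_firstUnitCoeff_le` ("one divisibility + `μ = 0` + `λ(𝓛) ≤ λ(𝔛)` ⟹ equality and `λ(𝓛) = λ(𝔛)`").
CONDITIONAL on the displayed named statements; nothing asserted about BSD. [claim: KellerYin2024PotOrd, status: under-review]
[cite: KellerYin2024b, Thm. 3.3.6, Prop. 3.4.4, §3.5 and Thm. 3.5.1 (arXiv:2410.23241 pp. 19–20) (preprint; hypotheses and the sentence derived)]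
[cite: CastellaGrossiLeeSkinner2022, Thm. 3.2.1 ("it suffices to prove one of the predicted divisibilities") and Thms. 1.2.2, 2.2.2, Prop. 14]
[cite: Washington1997, §7.1 Prop. 7.2 and §13.2] -/
theorem xac_charIdeal_map_eq_span_three_of_dvd
    (hAN : thm351_anacong_branch_three) (hBR : thm122_charLambda_pair_three)
    (hprop125 : prop125_characterGrSelmerDual_torsion_muZero_dim) (hfact : prop14_residualCharacterSelmer_finite)
    (hlift : cor126_residualCharacter_globalLift) (hlocal : cor126_residualCharacter_localSurjective)
    (h411 : prop411_selmer_isAlmostDivisible) (h263 : prop263_sur_of_crk) (h41 : prop41_globalEulerPoincareCorank)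
    (h42 : prop42_localEulerPoincareCorank) (h5A : sec5A_localH2_subsingleton_of_LOC1)
    (h32 : prop32_cohomology_isCofinitelyGenerated)
    (hDVD : thm336_dvd_branch_OPEN)
    (ι' : PadicAlgCl 3 ≃+* ℂ) (W : WeierstrassCurve ℚ) [W.IsElliptic] [W.IsGloballyMinimal]
    (K : Type) [Field K] [NumberField K] [IsGalois ℚ K]
    (v vbar : HeightOneSpectrum (𝓞 K)) (κ : ZpExtension K 3) (γ : absoluteGaloisGroup K)
    [hγ : Fact (κ.IsTopGenerator γ)] {N : ℕ} [NeZero N] {f : CuspForm (CongruenceSubgroup.Gamma0 N) 2}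
    (hf : IsNewformOf W f) (hS : PotOrdSetting ι' W K v vbar κ N)
    (hX : ClassX3 W 3) (hSG : SubGordTwo W 3)
    (hna : ∀ (V : WeierstrassCurve ℚ) [V.IsElliptic] [V.IsGloballyMinimal] (C : VariableChange ℚ),
      GoodOrd V 3 → C • V.quadraticTwist ((-1 : ℚ) ^ (3 / 2) * (3 : ℕ)) = W → ¬ (3 : ℤ) ∣ V.frobeniusTrace 3 - 1)
    (hv3 : ((3 : ℕ) : 𝓞 K) ∈ v.asIdeal)
    {N' : ℕ} [NeZero N'] {f' : CuspForm (CongruenceSubgroup.Gamma0 N') 2} (hf' : IsNewform0 f') (hN' : ¬ 3 ∣ N')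
    (htw : ∃ S : Finset ℕ, ∀ ℓ : ℕ, ℓ.Prime → ℓ ∉ S →
      cuspCoeff f ℓ = ((legendreSym 3 ℓ : ℤ) : ℂ) * cuspCoeff f' ℓ)
    {θsub θquot : FramedGaloisRep K (padicCoeffIntegers (∅ : Set (PadicAlgCl 3))) 1}
    (hpair : IsResidualPairOver (W.baseChange K) 3 θsub θquot)
    {θ₀ : FramedGaloisRep K (padicCoeffIntegers (∅ : Set (PadicAlgCl 3))) 1} (hθ₀ : θ₀ = θsub ∨ θ₀ = θquot)
    {θ₀K : HeckeCharacter K} (hθ₀K : IsHeckeCharOf ι' θ₀ θ₀K) (hv0 : θ₀K.IsUnramifiedAt v) (hvbar0 : θ₀K.IsUnramifiedAt vbar)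
    {Cbar : Finset (HeightOneSpectrum (𝓞 K))} (hCbar : ∀ u ∈ Cbar, ¬ θ₀K.IsUnramifiedAt u)
    {ΩK' : ℂ} {Ωp' : (unrIntegers 3)ˣ} {Lφ : UnrSeries 3} (hΩK' : ΩK' ≠ 0)
    (hLφ : IsKatzLFunction ι' v vbar Cbar κ γ θ₀K ΩK' ((Ωp' : unrIntegers 3) : ℂ_[3]) Lφ)
    {e : ℂ} {ΩK : ℂ} {Ωp : (unrIntegers 3)ˣ} {L : UnrSeries 3} (he : e = 1 ∨ e = -1) (hΩK : ΩK ≠ 0)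
    (hL : IsBranchBDPLFunction ι' v κ γ f' (KellerYin2024.genusHeckeCharacter K 3) e ΩK ((Ωp : unrIntegers 3) : ℂ_[3]) L)
    (j : ℤ_[3] →+* unrIntegers 3)
    (hj : ∀ x : ℤ_[3], ((j x : unrIntegers 3) : ℂ_[3]) = algebraMap ℚ_[3] ℂ_[3] (x : ℚ_[3])) :
    (XAc.charIdeal (W.baseChange K) 3 κ vbar (∅ : Set (HeightOneSpectrum (𝓞 K))) γ).map (PowerSeries.map j) =
        Ideal.span {L} ∧
      ∃ n : ℕ, FirstUnitCoeffAt L n ∧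
        n = lambdaInvariant 3 (XAc (W.baseChange K) 3 κ vbar (∅ : Set (HeightOneSpectrum (𝓞 K))) γ) := by
  -- §1: `μ(L) = 0`, `λ(L) ≤ λ(𝔛)`
  obtain ⟨n, hLn, hle⟩ := exists_firstUnitCoeffAt_le_lambdaInvariant_three hAN hBR hprop125 hfact hlift hlocal h411 h263 h41 h42
    h5A h32 ι' W K v vbar κ γ hf hS hX hSG hna hv3 hf' hN' htw hpair hθ₀ hθ₀K hv0 hvbar0 hCbar hΩK' hLφ he hΩK hL
  -- `𝔛` torsion with `μ = 0` (CGLS Prop. 14, generation 25)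
  obtain ⟨hT, hμ⟩ := isTorsion_muInvariant_eq_zero_empty_of_prop14_of_subGordTwo_of_forall_twist hfact W K vbar κ γ
    (by norm_num) hX hSG hna hS.imagQuad (by rw [hS.level]; exact hS.heegner) hS.split hS.mem_vbar hS.anticyclotomic
  -- [DIV.dvd] at this frame
  have he0 : e ≠ 0 := by rcases he with rfl | rfl <;> norm_num
  have hΩp0 : ((Ωp : unrIntegers 3) : ℂ_[3]) ≠ 0 := by
    rw [Ne, ZeroMemClass.coe_eq_zero]; exact Ωp.ne_zero
  obtain ⟨k, hk⟩ := hDVD ι' W K v vbar κ γ hf hS hf' hN' htw e ΩK _ L he0 hΩK hΩp0 hL j hj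
  -- the hinge (generation 24)
  haveI : Module.Finite (IwasawaAlgebra 3) (XAc (W.baseChange K) 3 κ vbar (∅ : Set (HeightOneSpectrum (𝓞 K))) γ) :=
    XAc.module_finite_empty _ 3 κ vbar γ
  obtain ⟨heq, hn⟩ := charIdeal_map_eq_span_of_C_pow_mul_mem_of_firstUnitCoeff_le _ hT hμ j hj hLn hle hk
  exact ⟨heq, n, hLn, hn⟩

/-- **The door direction H3 at the frame** (`Ch_Λ(X_ac^∅(W_K))·R₀⟦T⟧ ⊆ (L)`, the input of generation 21's isogeny descent
`xac_charIdeal_map_le_span_of_KY_branch_of_castellaHsieh_signed`), at `p = 3` for a non-anomalous twist, from [DIV.dvd] + [AN3] + [BR3] +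
published facts. [claim: KellerYin2024PotOrd, status: under-review]
[cite: KellerYin2024b, Thm. 3.5.1 (arXiv:2410.23241 p. 20) (preprint; the door direction of its conclusion)] -/
theorem xac_charIdeal_map_le_span_three_of_dvd
    (hAN : thm351_anacong_branch_three) (hBR : thm122_charLambda_pair_three)
    (hprop125 : prop125_characterGrSelmerDual_torsion_muZero_dim) (hfact : prop14_residualCharacterSelmer_finite)
    (hlift : cor126_residualCharacter_globalLift) (hlocal : cor126_residualCharacter_localSurjective)
    (h411 : prop411_selmer_isAlmostDivisible) (h263 : prop263_sur_of_crk) (h41 : prop41_globalEulerPoincareCorank)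
    (h42 : prop42_localEulerPoincareCorank) (h5A : sec5A_localH2_subsingleton_of_LOC1)
    (h32 : prop32_cohomology_isCofinitelyGenerated)
    (hDVD : thm336_dvd_branch_OPEN)
    (ι' : PadicAlgCl 3 ≃+* ℂ) (W : WeierstrassCurve ℚ) [W.IsElliptic] [W.IsGloballyMinimal]
    (K : Type) [Field K] [NumberField K] [IsGalois ℚ K]
    (v vbar : HeightOneSpectrum (𝓞 K)) (κ : ZpExtension K 3) (γ : absoluteGaloisGroup K)
    [hγ : Fact (κ.IsTopGenerator γ)] {N : ℕ} [NeZero N] {f : CuspForm (CongruenceSubgroup.Gamma0 N) 2}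
    (hf : IsNewformOf W f) (hS : PotOrdSetting ι' W K v vbar κ N)
    (hX : ClassX3 W 3) (hSG : SubGordTwo W 3)
    (hna : ∀ (V : WeierstrassCurve ℚ) [V.IsElliptic] [V.IsGloballyMinimal] (C : VariableChange ℚ),
      GoodOrd V 3 → C • V.quadraticTwist ((-1 : ℚ) ^ (3 / 2) * (3 : ℕ)) = W → ¬ (3 : ℤ) ∣ V.frobeniusTrace 3 - 1)
    (hv3 : ((3 : ℕ) : 𝓞 K) ∈ v.asIdeal)
    {N' : ℕ} [NeZero N'] {f' : CuspForm (CongruenceSubgroup.Gamma0 N') 2} (hf' : IsNewform0 f') (hN' : ¬ 3 ∣ N')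
    (htw : ∃ S : Finset ℕ, ∀ ℓ : ℕ, ℓ.Prime → ℓ ∉ S →
      cuspCoeff f ℓ = ((legendreSym 3 ℓ : ℤ) : ℂ) * cuspCoeff f' ℓ)
    {θsub θquot : FramedGaloisRep K (padicCoeffIntegers (∅ : Set (PadicAlgCl 3))) 1}
    (hpair : IsResidualPairOver (W.baseChange K) 3 θsub θquot)
    {θ₀ : FramedGaloisRep K (padicCoeffIntegers (∅ : Set (PadicAlgCl 3))) 1} (hθ₀ : θ₀ = θsub ∨ θ₀ = θquot)
    {θ₀K : HeckeCharacter K} (hθ₀K : IsHeckeCharOf ι' θ₀ θ₀K) (hv0 : θ₀K.IsUnramifiedAt v) (hvbar0 : θ₀K.IsUnramifiedAt vbar)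
    {Cbar : Finset (HeightOneSpectrum (𝓞 K))} (hCbar : ∀ u ∈ Cbar, ¬ θ₀K.IsUnramifiedAt u)
    {ΩK' : ℂ} {Ωp' : (unrIntegers 3)ˣ} {Lφ : UnrSeries 3} (hΩK' : ΩK' ≠ 0)
    (hLφ : IsKatzLFunction ι' v vbar Cbar κ γ θ₀K ΩK' ((Ωp' : unrIntegers 3) : ℂ_[3]) Lφ)
    {e : ℂ} {ΩK : ℂ} {Ωp : (unrIntegers 3)ˣ} {L : UnrSeries 3} (he : e = 1 ∨ e = -1) (hΩK : ΩK ≠ 0)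
    (hL : IsBranchBDPLFunction ι' v κ γ f' (KellerYin2024.genusHeckeCharacter K 3) e ΩK ((Ωp : unrIntegers 3) : ℂ_[3]) L)
    (j : ℤ_[3] →+* unrIntegers 3)
    (hj : ∀ x : ℤ_[3], ((j x : unrIntegers 3) : ℂ_[3]) = algebraMap ℚ_[3] ℂ_[3] (x : ℚ_[3])) :
    (XAc.charIdeal (W.baseChange K) 3 κ vbar (∅ : Set (HeightOneSpectrum (𝓞 K))) γ).map (PowerSeries.map j) ≤
      Ideal.span {L} :=
  (xac_charIdeal_map_eq_span_three_of_dvd hAN hBR hprop125 hfact hlift hlocal h411 h263 h41 h42 h5A h32 hDVD ι' W K v vbar κ γ hf hS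
    hX hSG hna hv3 hf' hN' htw hpair hθ₀ hθ₀K hv0 hvbar0 hCbar hΩK' hLφ he hΩK hL j hj).1.le

end Three

end Summit.BirchSwinnertonDyer.BirchSwinnertonDyer.Theorems.SchneiderFreeAdditiveX3.KYBranchThree

end
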